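import Summits.KontsevichZagierPeriods.KontsevichZagierPeriods.Theses.FermatIsogeny
import Summits.KontsevichZagierPeriods.KontsevichZagierPeriods.Theses.SymplecticScissors
import Summits.KontsevichZagierPeriods.KontsevichZagierPeriods.Theorems.RealOnePeriodRelations.Negative.Kit
import Summits.KontsevichZagierPeriods.KontsevichZagierPeriods.Theorems.FermatIsogenyBetaLinearSectorSplit
import Summits.KontsevichZagierPeriods.KontsevichZagierPeriods.Theorems.FermatIsogenyBetaLinearSectorStubBandNewtonLeibnizCad
import Summits.KontsevichZagierPeriods.KontsevichZagierPeriods.Theorems.IsogenyCertificatesGenusTwoRealPeriodCellStubSubband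
import Summits.KontsevichZagierPeriods.KontsevichZagierPeriods.Theorems.FermatIsogenyBetaLinearSectorStubBandNewtonLeibnizEngine
import Summits.KontsevichZagierPeriods.KontsevichZagierPeriods.Theorems.FermatIsogenyBetaLinearSectorStubGreenOfEngine
import Summits.KontsevichZagierPeriods.KontsevichZagierPeriods.Theorems.SymplecticScissorsRealOnePeriodRelationsConditional
import Literature.NumberTheory.Transcendental.CurvePeriods
import Literature.NumberTheory.Transcendental.KZCalculus

/-!
# The Green lemma `greenSet ⊆ KZ.relations`, UNCONDITIONALLY — and `BetaLinearSector` from Huber–Wüstholz alone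

GREEN'S FORMULA ON THE NATIVE TRIANGLE IS A CHAIN OF KONTSEVICH–ZAGIER MOVES.  The typed Green generator of crux
`RealOnePeriodRelations` (stmt-10042; `greenSet` of `Theorems/RealOnePeriodRelations/Negative/Kit.lean`: for `A da + B db` with a
`C¹` potential on the open standard triangle and `A, B` continuous `ℚ`-semialgebraic on the closed one, the formal combination
`[∫₀¹A(t,0)dt] + [∫₀¹(B−A)(1−t,t)dt] − [∫₀¹B(0,t)dt]`) lies in `KZ.relations` — assembled from the four registered Green stubs of
line `fermat-sector-transport` of crux `BetaLinearSector` (stmt-3897), all landed theorems: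
`stub_bandNewtonLeibniz_cad` (two-set adapted cylindrical decomposition), `stub_bandNewtonLeibniz_subband` (one Newton–Leibniz move
per sub-band — landed verbatim as `GenusTwoRealPeriodCellLine.stub_subband` by the parallel lead of crux stmt-17657, whose line runs the
same Green chain), `stub_bandNewtonLeibniz_of_cad_of_subband` (the engine: Newton–Leibniz down a band off a null set) and
`stub_greenInRelations_of_bandNewtonLeibniz` (Green = engine ×2 + swap + reflection + rule 1b, over the landed `PlanarAreas` stubs).
This is ALSO the open glue stub `stub_greenInRelations` of crux `PlanarAreas` (stmt-4990) and of crux `GenusTwoRealPeriodCell`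
(stmt-17657), verbatim.

Consequences recorded here: `M₁ ≤ KZ.relations` (`M₁ = closure (1a ∪ 1b ∪ 2 ∪ Green)`), hence EVERY conclusion "`∈ M₁`" of the
sibling programme is a conclusion "`∈ relations`"; in particular `RealOnePeriodRelations → ∀ r r' : IntegralRep 1, r.value = r'.value →
Equivalent r r'` and — the terminal form of this crux — **`BetaLinearSector` from the named fact `HuberWustholzCurvePeriods` ALONE**
(`BetaLinearSector_of_huberWustholzCurvePeriods`, through the landed `BetaLinearSector_of_subs`).

References: M. Kontsevich, D. Zagier, *Periods* (2001), §1.2; A. Huber, G. Wüstholz, *Transcendence and linear relations of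
1-periods* (2022), Thm 13.3 (2).
-/

noncomputable section

namespace Summit.KontsevichZagierPeriods.FermatIsogeny.BetaLinearSector

open Literature.NumberTheory.Transcendental
open Summit.KontsevichZagierPeriods.SymplecticScissors.RealOnePeriodRelationsNegative (greenSet M₁ H₁ crux_iff)
open Summit.KontsevichZagierPeriods.KontsevichZagierPeriods.Theses.FermatIsogeny (BetaLinearSector)

/-- **THE GREEN LEMMA**: every instance of the typed Green generator lies in `KZ.relations` (Green's formula on the standard
triangle is a chain of moves). Unconditional. [cite: KontsevichZagier2001, §1.2 rules (1)–(3)] -/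
theorem greenInRelations :
    ∀ g ∈ Summit.KontsevichZagierPeriods.SymplecticScissors.RealOnePeriodRelationsNegative.greenSet,
      g ∈ Literature.NumberTheory.Transcendental.KZ.relations :=
  stub_greenInRelations_of_bandNewtonLeibniz
    (stub_bandNewtonLeibniz_of_cad_of_subband stub_bandNewtonLeibniz_cad
      Summit.KontsevichZagierPeriods.IsogenyCertificates.GenusTwoRealPeriodCellLine.stub_subband)

/-- `M₁ = closure (1a ∪ 1b ∪ 2 ∪ Green) ≤ KZ.relations`, unconditionally. [cite: KontsevichZagier2001, §1.2] -/
theorem M₁_le_relations : M₁ ≤ KZ.relations :=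
  M₁_le_relations_of_green greenInRelations

/-- `RealOnePeriodRelations` (crux stmt-10042, conclusion in `M₁`) implies Conjecture 1 for ALL pairs of one-dimensional
representations with equal values (conclusion in `relations`). [cite: KontsevichZagier2001, §1.2] -/
theorem equivalent_of_realOnePeriodRelations
    (hR : Summit.KontsevichZagierPeriods.KontsevichZagierPeriods.Theses.SymplecticScissors.RealOnePeriodRelations)
    (r r' : KZ.IntegralRep 1) (hv : r.value = r'.value) : KZ.Equivalent r r' := by
  have hmem : KZ.of r - KZ.of r' ∈ H₁ :=
    H₁.sub_mem (AddSubgroup.subset_closure ⟨r, rfl⟩) (AddSubgroup.subset_closure ⟨r', rfl⟩)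
  have heval : KZ.eval (KZ.of r - KZ.of r') = 0 := by
    rw [map_sub, KZ.eval_of, KZ.eval_of, hv, sub_self]
  exact M₁_le_relations ((crux_iff.mp hR) _ hmem heval)

/-- **Conjecture 1 for ALL pairs of one-dimensional representations with equal values, from the named fact
`HuberWustholzCurvePeriods` alone** (through the landed `realOnePeriodRelations_of_huberWustholzCurvePeriods` of stmt-10042 and
the Green lemma): the master corollary of which `BetaLinearSector`, `IsogenyLinearNinth`, `EulerReflectionRational`, … are
instances. CONDITIONAL on the named fact. [cite: HuberWustholz2022, Thm 13.3 (2)] -/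
theorem equivalent_of_value_eq_of_huberWustholzCurvePeriods
    (h : Literature.NumberTheory.Transcendental.HuberWustholzCurvePeriods)
    (r r' : KZ.IntegralRep 1) (hv : r.value = r'.value) : KZ.Equivalent r r' :=
  equivalent_of_realOnePeriodRelations
    (Summit.KontsevichZagierPeriods.SymplecticScissors.RealOnePeriodRelations.realOnePeriodRelations_of_huberWustholzCurvePeriods
      h) r r' hv

/-- **`BetaLinearSector` from the named fact `HuberWustholzCurvePeriods` alone** (the terminal form of crux stmt-3897 on line
`fermat-sector-transport` / `hw-real-transport`: CLOSED MODULO the Literature named fact Huber–Wüstholz 2022 Thm 13.3 (2)).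
[cite: HuberWustholz2022, Thm 13.3 (2)] -/
theorem BetaLinearSector_of_huberWustholzCurvePeriods
    (h : Literature.NumberTheory.Transcendental.HuberWustholzCurvePeriods) :
    Summit.KontsevichZagierPeriods.KontsevichZagierPeriods.Theses.FermatIsogeny.BetaLinearSector :=
  fun _ _ _ _ _ _ _ _ _ _ r r' _ _ _ _ hv => equivalent_of_value_eq_of_huberWustholzCurvePeriods h r r' hv

end Summit.KontsevichZagierPeriods.FermatIsogeny.BetaLinearSector

end
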